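import Mathlib.Algebra.MonoidAlgebra.Basic
import Mathlib.LinearAlgebra.Basis.Basic
import Mathlib.LinearAlgebra.Span.Basic
import Literature.Barriers.MatrixMultiplication.NilpotentGroupBarrierSawin
import HarnessLib

/-!
# Graded coordinates on a group algebra and the codimension bound on slice rank (BCCGU 2017, Prop. 3.2, Prop. 3.10 and Lemma 3.21 in coordinates)

Topic `Literature/Barriers/MatrixMultiplication`; third proof file attached to the catalogue
entry `NilpotentGroupBarrier.lean` (towards the discharge of `BCCGU2017_cor320`,
Blasiak–Church–Cohn–Grochow–Umans 2017, Cor. 3.20). It isolates, in the coordinate language of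
the tree's slice-rank API (`HasSliceRankLE`, `sliceRank`, `mulGroupTensor`), the mechanism by
which BCCGU bound the slice rank of a group algebra:

* Prop. 3.2: subspaces `A · B ⊆ C` of an algebra `𝒟` give
  `slice-rank(M_𝒟) ≤ codim A + codim B + dim C` — applied with `A = B = I^a`, `C = I^{a+b}` for
  the augmentation ideal `I` of `𝔽_p[P]` (Lemma 3.3) in a basis adapted to the powers of `I`
  (the Jennings basis, Prop. 3.10: "`dim I^k` is the number of monomials with degree `≥ k`");
* Lemma 3.21: extension from a normal subgroup `N ◁ G` to `G` at the cost of a factor `|G/N|`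
  (we only need the case of a direct factor, which is a tensor product of bases).

Source: J. Blasiak, T. Church, H. Cohn, J. A. Grochow, C. Umans, *Which groups are amenable to
proving exponent two for matrix multiplication?*, arXiv:1712.02302
[BlasiakChurchCohnGrochowUmans2017], §2.3 (change of basis), Lemma 3.1, Prop. 3.2, Lemma 3.3,
Prop. 3.10, Lemma 3.21 (held text `paper:arxiv-1712.02302`, pp. 5–8).

## Content (all proved)

* `GradedCoords K G Λ`: a family `β_i = Σ_x P(i,x) x` of `K[G]` indexed by a finite type `Λ`
  with a left inverse `Q` of the transition matrix and a degree `deg : Λ → ℕ` such that the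
  structure constants in the basis `β` are graded (`c'(i,j;k) ≠ 0 ⟹ deg i + deg j ≤ deg k`,
  i.e. `F_a · F_b ⊆ F_{a+b}` for `F_a = span{β_k : deg k ≥ a}`).
* `GradedCoords.hasSliceRankLE` / `.sliceRank_le`: **Prop. 3.2 in coordinates**,
  `slice-rank D_G ≤ #{deg < a} + #{deg < b} + #{deg ≥ a+b}` (change of basis
  `mulGroupTensor_eq_subst` + `HasSliceRankLE.of_graded` and `.subst_*` from
  `NilpotentGroupBarrierSawin.lean`).
* `GradedCoords.trivial` (group basis, degree `0`), `GradedCoords.prod` (tensor basis of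
  `K[G₁ × G₂]`, total degree; with the trivial factor this is **Lemma 3.21 for a direct
  factor**, `card_prod_trivial`: the counts multiply by `|G₂|`).
* `GradedCoords.ofBasis`: a genuine basis `β : Module.Basis Λ K (MonoidAlgebra K G)` with
  `β_i β_j ∈ span{β_k : deg i + deg j ≤ deg k}` gives graded coordinates (`Q = β.repr`) — the
  entry point for the Jennings-type monomial basis of `𝔽_p[P]` (**Prop. 3.10**, constructed in the
  sibling files `NilpotentGroupBarrierPWords.lean` / `…PStraighten.lean`).
* `sliceRank_mulGroupTensor_congr`: invariance of `slice-rank D_G` under group isomorphisms.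
-/

noncomputable section

open scoped BigOperators
open Finset

namespace Literature.Barriers.MatrixMultiplication

open Literature.Combinatorics.Additive

universe u v w

/-! ## Graded coordinates -/

section Defs

variable (K : Type v) [Field K] (G : Type u) [Group G] [Fintype G] [DecidableEq G] (Λ : Type w)
  [Fintype Λ]

/-- **Graded coordinates** on the group algebra `K[G]`: a family `β_i = Σ_x P(i,x)·x` (`i ∈ Λ`)
with a left inverse `x = Σ_i Q(x,i) β_i` of the transition matrix (`Σ_i Q(a,i)P(i,b) = [a=b]`,
so `β` is a basis) and a degree `deg : Λ → ℕ` such that the structure constants of `K[G]` in the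
basis `β` are GRADED: the coefficient of `β_k` in `β_i β_j` vanishes unless
`deg i + deg j ≤ deg k`. This is the coordinate form of "subspaces `A·B ⊆ C`" in
Blasiak–Church–Cohn–Grochow–Umans 2017, Prop. 3.2 / Lemma 3.3 (there `A = B = I^a`, `C = I^{2a}`
for an ideal `I`, the basis being adapted to the powers of `I`, Prop. 3.10), and of the filtered
bases of Sawin 2018, §2. [cite: BlasiakChurchCohnGrochowUmans2017, Prop. 3.2 and Prop. 3.10] -/
structure GradedCoords where
  /-- transition matrix: `β_i = Σ_x P i x · x` -/
  P : Λ → G → K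
  /-- left inverse: `x = Σ_i Q x i · β_i` -/
  Q : G → Λ → K
  /-- degree of the basis vector `β_i` -/
  deg : Λ → ℕ
  /-- `Q P = 1` on `G` -/
  sum_Q_mul_P : ∀ a b : G, ∑ i, Q a i * P i b = if a = b then 1 else 0
  /-- the structure constants in the basis `β` are graded -/
  graded : ∀ i j k : Λ, (∑ x, P i x * ∑ y, P j y * Q (x * y) k) ≠ 0 → deg i + deg j ≤ deg k

end Defs

namespace GradedCoords

variable {K : Type v} [Field K] {G : Type u} [Group G] [Fintype G] [DecidableEq G] {Λ : Type w}
  [Fintype Λ]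

/-- The structure constants `c'(i,j;k)` of `K[G]` in the basis `β`:
`β_i β_j = Σ_k c'(i,j;k) β_k`. [cite: BlasiakChurchCohnGrochowUmans2017, §2.3] -/
def strConst (B : GradedCoords K G Λ) (i j k : Λ) : K :=
  ∑ x, B.P i x * ∑ y, B.P j y * B.Q (x * y) k

/-- Contraction against `Q`: `Σ_i Q(x,i) Σ_{x'} P(i,x') F(x') = F(x)`. [folklore] -/
theorem sum_Q_mul_sum (B : GradedCoords K G Λ) (x : G) (F : G → K) :
    ∑ i, B.Q x i * ∑ x', B.P i x' * F x' = F x := by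
  simp_rw [Finset.mul_sum, ← mul_assoc]
  rw [Finset.sum_comm]
  simp_rw [← Finset.sum_mul, B.sum_Q_mul_P, ite_mul, one_mul, zero_mul, Finset.sum_ite_eq,
    Finset.mem_univ, if_true]

/-- **`D_G` in the coordinates `β`**: `[xyz = 1] = Σ_k P(k,z⁻¹) Σ_j Q(y,j) Σ_i Q(x,i) c'(i,j;k)`.
[cite: BlasiakChurchCohnGrochowUmans2017, §2.3] -/
theorem mulGroupTensor_eq_subst (B : GradedCoords K G Λ) :
    mulGroupTensor K G = fun x y z =>
      ∑ k, B.P k z⁻¹ * ∑ j, B.Q y j * ∑ i, B.Q x i * B.strConst i j k := by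
  funext x y z
  have h1 : ∀ j k : Λ, ∑ i, B.Q x i * B.strConst i j k =
      ∑ y', B.P j y' * B.Q (x * y') k := fun j k => B.sum_Q_mul_sum x _
  simp_rw [h1]
  have h2 : ∀ k : Λ, ∑ j, B.Q y j * ∑ y', B.P j y' * B.Q (x * y') k = B.Q (x * y) k :=
    fun k => B.sum_Q_mul_sum y (fun y' => B.Q (x * y') k)
  simp_rw [h2, mul_comm (B.P _ _) (B.Q _ _), B.sum_Q_mul_P, mulGroupTensor_apply,
    eq_inv_iff_mul_eq_one]

/-- **The codimension bound** (BCCGU 2017, Prop. 3.2 / Lemma 3.3 in coordinates): graded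
coordinates give `slice-rank D_G ≤ #{i : deg i < a} + #{j : deg j < b} + #{k : a + b ≤ deg k}`.
[cite: BlasiakChurchCohnGrochowUmans2017, Prop. 3.2] -/
theorem hasSliceRankLE (B : GradedCoords K G Λ) [DecidableEq Λ] (a b : ℕ) :
    HasSliceRankLE (mulGroupTensor K G)
      (Fintype.card {i : Λ // B.deg i < a} + Fintype.card {j : Λ // B.deg j < b} +
        Fintype.card {k : Λ // a + b ≤ B.deg k}) := by
  rw [B.mulGroupTensor_eq_subst]
  exact (((HasSliceRankLE.of_graded B.strConst B.deg B.deg B.deg B.graded a b).subst_left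
    B.Q).subst_mid B.Q).subst_right (fun z k => B.P k z⁻¹)

/-- The codimension bound in `sliceRank` form. [cite: BlasiakChurchCohnGrochowUmans2017, Prop. 3.2] -/
theorem sliceRank_le (B : GradedCoords K G Λ) [DecidableEq Λ] (a b : ℕ) :
    sliceRank (mulGroupTensor K G) ≤
      Fintype.card {i : Λ // B.deg i < a} + Fintype.card {j : Λ // B.deg j < b} +
        Fintype.card {k : Λ // a + b ≤ B.deg k} :=
  (B.hasSliceRankLE a b).sliceRank_le

/-! ### The trivial grading -/

variable (K G) in
/-- The trivial graded coordinates: the group basis, all degrees `0`. [folklore] -/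
def trivial : GradedCoords K G G where
  P i x := if x = i then 1 else 0
  Q x i := if i = x then 1 else 0
  deg _ := 0
  sum_Q_mul_P a b := by
    simp only [ite_mul, one_mul, zero_mul, Finset.sum_ite_eq', Finset.mem_univ, if_true]
    by_cases h : a = b
    · simp [h]
    · simp [h, Ne.symm h]
  graded _ _ _ _ := by simp

/-- The trivial grading has degree `0`. [folklore] -/
@[simp] theorem trivial_deg (i : G) : (trivial K G).deg i = 0 := rfl

/-! ### Products -/

/-- **Product of graded coordinates** (`K[G₁ × G₂] = K[G₁] ⊗ K[G₂]` with the tensor basis and the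
total degree; the case `deg₂ = 0` is BCCGU 2017, Lemma 3.21 for a direct factor).
[cite: BlasiakChurchCohnGrochowUmans2017, Lemma 3.21] -/
def prod {G₂ : Type*} [Group G₂] [Fintype G₂] [DecidableEq G₂] {Λ₂ : Type*} [Fintype Λ₂]
    (B : GradedCoords K G Λ) (B₂ : GradedCoords K G₂ Λ₂) : GradedCoords K (G × G₂) (Λ × Λ₂) where
  P i x := B.P i.1 x.1 * B₂.P i.2 x.2
  Q x i := B.Q x.1 i.1 * B₂.Q x.2 i.2
  deg i := B.deg i.1 + B₂.deg i.2
  sum_Q_mul_P a b := by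
    have h : ∀ i : Λ × Λ₂, B.Q a.1 i.1 * B₂.Q a.2 i.2 * (B.P i.1 b.1 * B₂.P i.2 b.2) =
        (B.Q a.1 i.1 * B.P i.1 b.1) * (B₂.Q a.2 i.2 * B₂.P i.2 b.2) := fun i => by ring
    simp_rw [h]
    rw [Fintype.sum_prod_type' (fun i₁ i₂ => (B.Q a.1 i₁ * B.P i₁ b.1) * (B₂.Q a.2 i₂ * B₂.P i₂ b.2)),
      ← Finset.sum_mul_sum, B.sum_Q_mul_P, B₂.sum_Q_mul_P]
    rcases a with ⟨a₁, a₂⟩; rcases b with ⟨b₁, b₂⟩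
    by_cases h1 : a₁ = b₁ <;> by_cases h2 : a₂ = b₂ <;> simp [h1, h2]
  graded i j k hne := by
    -- the structure constants factor
    have hfac : (∑ x : G × G₂, B.P i.1 x.1 * B₂.P i.2 x.2 *
        ∑ y : G × G₂, B.P j.1 y.1 * B₂.P j.2 y.2 * (B.Q (x * y).1 k.1 * B₂.Q (x * y).2 k.2)) =
        (∑ x, B.P i.1 x * ∑ y, B.P j.1 y * B.Q (x * y) k.1) *
          (∑ x, B₂.P i.2 x * ∑ y, B₂.P j.2 y * B₂.Q (x * y) k.2) := by
      rw [Finset.sum_mul_sum, Fintype.sum_prod_type' (fun x₁ x₂ => B.P i.1 x₁ * B₂.P i.2 x₂ *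
        ∑ y : G × G₂, B.P j.1 y.1 * B₂.P j.2 y.2 * (B.Q ((x₁, x₂) * y).1 k.1 * B₂.Q ((x₁, x₂) * y).2 k.2))]
      refine Finset.sum_congr rfl fun x₁ _ => Finset.sum_congr rfl fun x₂ _ => ?_
      rw [Finset.mul_sum, Finset.mul_sum, Finset.mul_sum, Finset.sum_mul_sum,
        Fintype.sum_prod_type' (fun y₁ y₂ => B.P i.1 x₁ * B₂.P i.2 x₂ *
          (B.P j.1 y₁ * B₂.P j.2 y₂ * (B.Q ((x₁, x₂) * (y₁, y₂)).1 k.1 * B₂.Q ((x₁, x₂) * (y₁, y₂)).2 k.2)))]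
      refine Finset.sum_congr rfl fun y₁ _ => Finset.sum_congr rfl fun y₂ _ => ?_
      simp only [Prod.mk_mul_mk]
      ring
    rw [hfac] at hne
    have h1 := B.graded i.1 j.1 k.1 (left_ne_zero_of_mul hne)
    have h2 := B₂.graded i.2 j.2 k.2 (right_ne_zero_of_mul hne)
    omega

/-- Degrees in a product. [folklore] -/
@[simp] theorem prod_deg {G₂ : Type*} [Group G₂] [Fintype G₂] [DecidableEq G₂] {Λ₂ : Type*}
    [Fintype Λ₂] (B : GradedCoords K G Λ) (B₂ : GradedCoords K G₂ Λ₂) (i : Λ × Λ₂) :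
    (B.prod B₂).deg i = B.deg i.1 + B₂.deg i.2 := rfl

/-- Counting in a product with the trivial grading: `#{(i,h) : p (deg i)} = #{i : p (deg i)} · |G₂|`.
[folklore] -/
theorem card_prod_trivial {G₂ : Type*} [Group G₂] [Fintype G₂] [DecidableEq G₂]
    (B : GradedCoords K G Λ) (p : ℕ → Prop) [DecidablePred p] :
    Fintype.card {i : Λ × G₂ // p ((B.prod (trivial K G₂)).deg i)} =
      Fintype.card {i : Λ // p (B.deg i)} * Fintype.card G₂ := by
  rw [← Fintype.card_prod]
  refine Fintype.card_congr ?_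
  exact
    { toFun := fun x => (⟨x.1.1, by simpa using x.2⟩, x.1.2)
      invFun := fun y => ⟨(y.1.1, y.2), by simpa using y.1.2⟩
      left_inv := fun x => by simp
      right_inv := fun y => by simp }

/-! ### Graded coordinates from a multiplicatively filtered basis of `K[G]` -/

/-- **Graded coordinates from a basis**: a basis `β : Λ → K[G]` with a degree such that
`β_i β_j ∈ span{β_k : deg i + deg j ≤ deg k}` gives graded coordinates
(`P i x = β_i(x)`, `Q x i = (β.repr x)_i`). This is how a basis adapted to the powers of an
ideal (BCCGU 2017, Prop. 3.10: the Jennings basis and the powers of the augmentation ideal) is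
fed into Prop. 3.2. [cite: BlasiakChurchCohnGrochowUmans2017, Prop. 3.2 and Prop. 3.10] -/
def ofBasis (β : Module.Basis Λ K (MonoidAlgebra K G)) (deg : Λ → ℕ)
    (hmul : ∀ i j, β i * β j ∈ Submodule.span K (β '' {k | deg i + deg j ≤ deg k})) :
    GradedCoords K G Λ where
  P i x := (β i).coeff x
  Q x i := β.repr (MonoidAlgebra.of K G x) i
  deg := deg
  sum_Q_mul_P a b := by
    have h := congr_arg (fun f : MonoidAlgebra K G => f.coeff b) (β.sum_repr (MonoidAlgebra.of K G a))
    rw [MonoidAlgebra.of_apply, MonoidAlgebra.coeff_single, Finsupp.single_apply] at h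
    rw [← h, MonoidAlgebra.coeff_sum, Finsupp.coe_finsetSum, Finset.sum_apply]
    refine Finset.sum_congr rfl fun i _ => ?_
    rw [MonoidAlgebra.coeff_smul_apply, smul_eq_mul, MonoidAlgebra.of_apply]
  graded i j k hne := by
    -- the triple sum is the `k`-th coordinate of `β_i β_j`
    have hexp : ∀ f : MonoidAlgebra K G, f = ∑ x, f.coeff x • MonoidAlgebra.of K G x := fun f => by
      apply MonoidAlgebra.coeff_injective
      rw [MonoidAlgebra.coeff_sum]
      conv_lhs => rw [← Finsupp.univ_sum_single f.coeff]
      refine Finset.sum_congr rfl fun x _ => ?_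
      rw [MonoidAlgebra.coeff_smul, MonoidAlgebra.of_apply, MonoidAlgebra.coeff_single,
        Finsupp.smul_single_one]
    have hprod : β i * β j =
        ∑ x, ∑ y, ((β i).coeff x * (β j).coeff y) • MonoidAlgebra.of K G (x * y) := by
      conv_lhs => rw [hexp (β i), hexp (β j)]
      rw [Finset.sum_mul]
      refine Finset.sum_congr rfl fun x _ => ?_
      rw [Finset.mul_sum]
      refine Finset.sum_congr rfl fun y _ => ?_
      rw [smul_mul_smul_comm, map_mul, mul_smul]
    have hcoord : β.repr (β i * β j) k =
        ∑ x, (β i).coeff x * ∑ y, (β j).coeff y * β.repr (MonoidAlgebra.of K G (x * y)) k := by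
      rw [hprod, map_sum, Finsupp.coe_finsetSum, Finset.sum_apply]
      refine Finset.sum_congr rfl fun x _ => ?_
      rw [map_sum, Finsupp.coe_finsetSum, Finset.sum_apply, Finset.mul_sum]
      refine Finset.sum_congr rfl fun y _ => ?_
      rw [map_smul, Finsupp.smul_apply, smul_eq_mul, mul_assoc]
    rw [← hcoord] at hne
    have hsupp := β.repr_support_subset_of_mem_span (s := {k | deg i + deg j ≤ deg k}) (hmul i j)
    exact hsupp (Finsupp.mem_support_iff.2 hne)

/-- The degree of `ofBasis`. [folklore] -/
@[simp] theorem ofBasis_deg (β : Module.Basis Λ K (MonoidAlgebra K G)) (deg : Λ → ℕ)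
    (hmul : ∀ i j, β i * β j ∈ Submodule.span K (β '' {k | deg i + deg j ≤ deg k})) :
    (ofBasis β deg hmul).deg = deg := rfl

end GradedCoords

/-! ## Invariance of the slice rank of `D_G` under group isomorphisms -/

section Transport

variable {K : Type v} [Field K]

/-- `slice-rank D_G` is invariant under group isomorphisms. [folklore] -/
theorem sliceRank_mulGroupTensor_congr {G : Type u} [Group G] [Fintype G] [DecidableEq G]
    {G' : Type*} [Group G'] [Fintype G'] [DecidableEq G'] (e : G ≃* G') :
    sliceRank (mulGroupTensor K G) = sliceRank (mulGroupTensor K G') := by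
  have key : ∀ {A : Type u} [Group A] [Fintype A] [DecidableEq A] {B : Type _} [Group B]
      [Fintype B] [DecidableEq B] (f : A ≃* B),
      sliceRank (mulGroupTensor K A) ≤ sliceRank (mulGroupTensor K B) := by
    intro A _ _ _ B _ _ _ f
    have h := (hasSliceRankLE_sliceRank (K := K) (mulGroupTensor K B)).comp f f f
    refine (hasSliceRankLE_iff_sliceRank_le _ _).1 ?_
    convert h using 1
    funext x y z
    simp only [mulGroupTensor_apply, ← map_mul, EmbeddingLike.map_eq_one_iff]
  exact le_antisymm (key e) (key' e)
  where
  /-- the reverse inequality (same argument with `e.symm`, universe-polymorphic copy) -/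
  key' {A : Type u} [Group A] [Fintype A] [DecidableEq A] {B : Type _} [Group B] [Fintype B]
      [DecidableEq B] (f : A ≃* B) :
      sliceRank (mulGroupTensor K B) ≤ sliceRank (mulGroupTensor K A) := by
    have h := (hasSliceRankLE_sliceRank (K := K) (mulGroupTensor K A)).comp f.symm f.symm f.symm
    refine (hasSliceRankLE_iff_sliceRank_le _ _).1 ?_
    convert h using 1
    funext x y z
    simp only [mulGroupTensor_apply, ← map_mul, EmbeddingLike.map_eq_one_iff]

end Transport

end Literature.Barriers.MatrixMultiplication

end
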